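import Summits.Ventures.HodgeKum4.Theses.KummerFixedLocus
import Summits.Ventures.HodgeKum4.Theorems.LaneVDefs
import Summits.Ventures.HodgeKum4.Theorems.KummerFixedLocusL1HilbDefs
import Summits.Ventures.HodgeKum4.Theorems.KummerFixedLocusL1HilbCert
import Summits.Ventures.HodgeKum4.Theorems.KummerFixedLocusL1HilbEval
import Summits.Ventures.HodgeKum4.Theorems.KummerFixedLocusL1HilbSuperLie
import Summits.Ventures.HodgeKum4.Theorems.KummerFixedLocusL1HilbLehnSuper
import Summits.Ventures.HodgeKum4.Theorems.KummerFixedLocusL1HilbModel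
import Literature.AlgebraicGeometry.HilbertScheme.LefschetzDualTransfer
import Literature.AlgebraicGeometry.HilbertScheme.LefschetzDualHilbertScheme
import Literature.AlgebraicGeometry.HilbertScheme.TransferOperatorSuperCommutators
import Summits.Ventures.HodgeKum4.Theorems.KummerFixedLocusL1HilbSeam
import Summits.Ventures.HodgeKum4.Theorems.KummerFixedLocusL1HilbNumber
import Summits.Ventures.HodgeKum4.Theorems.KummerFixedLocusL1HilbJoin
import Summits.Ventures.HodgeKum4.Theorems.KummerFixedLocusL1HilbUnitReach
import HarnessLib

/-!
# CLOSER (p1 g5) of item stmt-Ventures-20306 (W-form) along p5 g0's registered line v2p5: `LefschetzGenerationHilb n` for EVERY `n` ⇒ `LefschetzGenerationHilbW 5` — the V2 mechanism, all six stubs discharged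

Line `v2p5` for crux stmt-Ventures-20306 (`…Theses.KummerFixedLocus.LefschetzGenerationHilb5 = LefschetzGenerationHilbW 5`, the W-form; the line proves the STRONGER ∀-instance form `LefschetzGenerationHilb n` for all `n` and applies `lefschetzGenerationHilbW_of_hilb`).  Definitions in the tree module `…Theorems.KummerFixedLocusL1HilbDefs`; stubs S-A/S-D/S-E are LANDED (`…L1HilbSuperLie`, `…L1HilbCert`, `…L1HilbEval`) and CALLED BY NAME below (no restatement); S-B and S-C are LANDED too (`…L1HilbLehnSuper`, `…L1HilbModel`); S-F `stub_span` is DISCHARGED by plan g19's seam `SF.stub_span_of_halves` (module `…L1HilbSeam`) from the two halves `SF.numberHalf` (p1 g5, `…L1HilbNumber`) and `SF.joinHalf` (p2 g12, `…L1HilbJoin`).  This file is the composition of p5 g0's registered skeleton `Lines/v2p5.lean` (0033cffddc93ed96) with the six stubs replaced by the landed theorems.  Re-cut of the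
planner's `v2line.lean` (stub_full / stub_units / stub_polarise) into SIX stubs whose interfaces are concrete Lean
objects (no `IsSuperTraceless`, no quantification over all supertraceless `φ`):

* `stub_superLie`   (S-A) super-version of Oberdieck Cor. 3.5: `[T_t(φ), T_{t'}(ψ)} = T_{t+t'}([φ,ψ})` for graded
                     `φ, ψ` of ANY integer degrees (odd allowed) and an even Casimir tensor.
* `stub_lehnSuper`  (S-B) Lehn/LQW `𝔊₀(y) = T₁(m_y)` for homogeneous `y` of ANY degree (odd allowed).
* `stub_model`      (S-C) transport: a basis `b : Fin 16 → H*(A)` (`b 0 = 1`, `b I ∈ H^{|I|}`) in which left cup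
                     product by `b I` is the integer matrix `mulMat I` of `Λ*ℤ⁴` and `Λ_A` is the matrix `lamMat`
                     (symplectic basis adapted to `α`, `α ∧ α ≠ 0` from the `𝔰𝔩₂`-relations, partner uniqueness).
* `stub_cert`       (S-D) the loop-superalgebra certificate (S2) as KERNEL identities of sparse `16 × 16` integer
                     matrices (a re-typing of `Literature.Computation.AbelianHilbFock.LieCertificate`, which is a
                     `native_decide`d `Bool` and not consumable).
* `stub_eval`       (S-E) loop-algebra evaluation + Vandermonde: the stabiliser algebra of `W` contains every
                     single-weight number operator `τ_k(id)|ₙ` and polarisation `τ_k(b I ⊗ b₀^∨)|ₙ`, `k ≤ n`.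
* `stub_span`       (S-F) shape projectors, unit monomials by Lehn's joins (`boundary_bracket`), polarisation,
                     Nakajima–Grojnowski cyclicity: such a `W ∋ 1` that is `𝔡`-stable is all of `H*(A^[n])`.

Composition `lefschetzGenerationHilb_of_stubs : ∀ n, LefschetzGenerationHilb n` (the ∀-n, ∀-instance form — K1_unif feeder)
and the crux BY NAME `lefschetzGenerationHilb5_holds : …Theses.KummerFixedLocus.LefschetzGenerationHilb5` (W-form, item
stmt-Ventures-20306).  0 sorry, standard axioms.  HONEST FRAMING: this proves L1-Hilb(n) for every n and every instance of the
Li–Qin–Wang interface with an even Casimir tensor; it does NOT prove L1 (`LefschetzGenerationKum4`, which still needs V0 +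
print), HC_Kum4Type or HC.
-/

noncomputable section

open CategoryTheory DirectSum
open scoped TensorProduct
open Literature.AlgebraicTopology.SingularHomology
open Literature.AlgebraicGeometry Literature.AlgebraicGeometry.Hyperkaehler Literature.AlgebraicGeometry.HilbertScheme
open Literature.AlgebraicGeometry.HodgeTheory (complexBetti)
open Literature.AlgebraicGeometry.Motives (AbelianVariety ComplexPoints SchemeOver IsSmoothProjective)

namespace Summit.Ventures.HodgeKum4.L1Hilb.V2p5Closer

open Summit.Ventures.HodgeKum4 Summit.Ventures.HodgeKum4.L1Hilb

variable {S : SchemeOver ℂ} {hS : IsSmoothProjective 2 S} {H : HilbertSchemesOfPoints S}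

/-! ### Composition (kernel-checked): the five landed stubs `L1Hilb.stub_*` and the S-F seam called BY NAME -/


/-- (S-F) **Cyclic unit monomials span** — the registered stub `stub_span` of `Lines/v2p5.lean`, header VERBATIM, DISCHARGED
by plan g19's seam from the two halves `SF.numberHalf` (p1 g5) and `SF.joinHalf_of_unitReach` (p2 g12) applied to the J1 theorem `unitReach` (plan g19 ∕ p5 g1).  A subspace `W ⊆ H*(S^[n])`
containing `1_{S^[n]}`, stable under Lehn's boundary operator `𝔡|ₙ = G₁(1_S, n) ∪ ·` and under all `τ_k(id)|ₙ`,
`τ_k(b i ⊗ b_{i₀}^∨)|ₙ` (`1 ≤ k ≤ n`) for a homogeneous basis `b` of `H*(S)` with `b i₀ = 1_S`, is everything. -/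
theorem stub_span (𝔊 : ChernCharacterOperators hS H)
    {C : totalCohomology ℂ (ComplexPoints S) ⊗[ℂ] totalCohomology ℂ (ComplexPoints S)}
    (hCg : C ∈ evenTensorSpan ℂ (coeffFamily S)) (hC : IsCasimir ℂ (poincarePairing hS) C)
    {ι : Type} [Fintype ι] [DecidableEq ι] (b : Module.Basis ι ℂ (totalCohomology ℂ (ComplexPoints S))) (i₀ : ι)
    (hb0 : b i₀ = unitCoeff S) (deg : ι → ℕ) (hb : ∀ i, b i ∈ LinearMap.range (ofDegree ℂ (ComplexPoints S) (deg i)))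
    (n : ℕ) (W : Submodule ℂ (totalCohomology ℂ (ComplexPoints (H.obj n))))
    (h1 : ofDegree ℂ (ComplexPoints (H.obj n)) 0 (singularCohomology.one ℂ (ComplexPoints (H.obj n))) ∈ W)
    (h𝔡 : ∀ w ∈ W, totalCup ℂ (ComplexPoints (H.obj n)) (𝔊.G 1 n (unitCoeff S)) w ∈ W)
    (hN : ∀ k, 1 ≤ k → k ≤ n → ∀ w ∈ W, twoPt 𝔊.toNakajimaOperators C LinearMap.id k n w ∈ W)
    (hP : ∀ k, 1 ≤ k → k ≤ n → ∀ i, i ≠ i₀ → ∀ w ∈ W, twoPt 𝔊.toNakajimaOperators C (polar b i₀ i) k n w ∈ W) :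
    W = ⊤ :=
  SF.stub_span_of_halves SF.numberHalf (SF.joinHalf_of_unitReach SF.unitReach) 𝔊 hCg hC b i₀ hb0 deg hb n W h1 h𝔡 hN hP

/-- A transfer operator preserves each `ℍₙ`; so `StableUnder n W (T)` reduces to the stability of `W` under `T|ₙ`. -/
theorem stableUnder_transferOp (𝔑 : NakajimaOperators hS H)
    (C : totalCohomology ℂ (ComplexPoints S) ⊗[ℂ] totalCohomology ℂ (ComplexPoints S)) (t : ℤ)
    (φ : Module.End ℂ (totalCohomology ℂ (ComplexPoints S))) (n : ℕ)
    (W : Submodule ℂ (totalCohomology ℂ (ComplexPoints (H.obj n))))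
    (h : ∀ w ∈ W, restrictFock ℂ (fockFamily H) (transferOp ℂ 𝔑.q C t φ) n w ∈ W) :
    StableUnder n W (transferOp ℂ 𝔑.q C t φ) :=
  ⟨fun y ↦ 𝔑.isHeisenberg.transferOp_apply_ofSummand_mem_range C t φ n y, h⟩

/-- **L1-Hilb(n) for every `n`, from the six stubs.** -/
theorem lefschetzGenerationHilb_of_stubs (n : ℕ) : LefschetzGenerationHilb n := by
  intro A hA hS H 𝔊 C hCg hC α Λ_A hΛA
  unfold LefschetzGenerationHilbAt
  set W := opCupSpan ℂ (ComplexPoints (H.obj n)) (transferDual 𝔊.toNakajimaOperators C Λ_A n)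
    (degreeClasses ℂ (ComplexPoints (H.obj n)) {0, 1, 2, 3}) with hW
  -- the model basis
  obtain ⟨b, hb0, hb, hmul, hlam⟩ := L1Hilb.stub_model hA α Λ_A hΛA
  -- closure properties of `W` by definition
  have hsub : degreeClasses ℂ (ComplexPoints (H.obj n)) {0, 1, 2, 3} ⊆ W := subset_opCupSpan
  have hcup : IsCupClosed W := isCupClosed_opCupSpan
  have hdual : transferDual 𝔊.toNakajimaOperators C Λ_A n ∈ stabilizerLie W := mem_stabilizerLie_opCupSpan
  -- generators: `T₁(m_{bI})|ₙ = 𝔊₀(b I)|ₙ = G₀(b I, n) ∪ ·` with `G₀(b I, n) ∈ H^{|I|} ⊆ W` for `|I| ≤ 3`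
  have hgen : ∀ I : Fin 16, deg4 I ∈ ({1, 2, 3} : Set ℕ) →
      StableUnder n W (transferOp ℂ 𝔊.q C 1 (totalCup ℂ (ComplexPoints A.X) (b I))) := by
    intro I hI
    refine stableUnder_transferOp 𝔊.toNakajimaOperators C 1 _ n W fun w hw ↦ ?_
    obtain ⟨y, hy⟩ := hb I
    rw [← hy, ← L1Hilb.stub_lehnSuper 𝔊 hCg hC (deg4 I) y, ChernCharacterOperators.cupOperator, restrictFock_fiberwise]
    refine hcup _ ?_ w hw
    obtain ⟨d, hd⟩ := 𝔊.G_degree 0 n (deg4 I) y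
    rw [← hd]
    refine hsub (ofDegree_mem_degreeClasses ?_ d)
    simp only [Set.mem_insert_iff, Set.mem_singleton_iff] at hI ⊢
    omega
  have hf : StableUnder n W (transferOp ℂ 𝔊.q C (-1) Λ_A) :=
    stableUnder_transferOp 𝔊.toNakajimaOperators C (-1) Λ_A n W fun w hw ↦ hdual w hw
  -- (S-E): number operators and polarisations stabilise `W`
  have hNP := L1Hilb.stub_eval L1Hilb.stub_cert 𝔊.toNakajimaOperators hCg hC
    (fun t t' φ ψ d d' hφ hψ ↦ L1Hilb.stub_superLie 𝔊.toNakajimaOperators hCg hC t t' hφ hψ) b hb hmul Λ_A hlam n W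
    hgen hf
  -- `1 ∈ W` and `𝔡`-stability (`G₁(1_S, n) ∈ H² ⊆ W`, `W` cup-closed)
  have h1 : ofDegree ℂ (ComplexPoints (H.obj n)) 0 (singularCohomology.one ℂ (ComplexPoints (H.obj n))) ∈ W :=
    hsub (ofDegree_mem_degreeClasses (by simp) _)
  have hG1 : 𝔊.G 1 n (unitCoeff A.X) ∈ W := by
    obtain ⟨d, hd⟩ := 𝔊.G_degree 1 n 0 (singularCohomology.one ℂ (ComplexPoints A.X))
    have hd' : ofDegree ℂ (ComplexPoints (H.obj n)) (0 + 2 * 1) d = 𝔊.G 1 n (unitCoeff A.X) := hd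
    rw [← hd']
    exact hsub (ofDegree_mem_degreeClasses (by norm_num) d)
  have h𝔡 : ∀ w ∈ W, totalCup ℂ (ComplexPoints (H.obj n)) (𝔊.G 1 n (unitCoeff A.X)) w ∈ W :=
    fun w hw ↦ hcup _ hG1 w hw
  -- (S-F)
  exact stub_span 𝔊 hCg hC b 0 hb0 deg4 hb n W h1 h𝔡 (fun k hk hkn ↦ (hNP k hk hkn).1)
    (fun k hk hkn i hi ↦ (hNP k hk hkn).2 i hi)

/-- **The crux BY NAME**: `…Theses.KummerFixedLocus.LefschetzGenerationHilb5` (= `LefschetzGenerationHilbW 5`, the W-form),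
from the ∀-instance form at `n = 5`. -/
theorem LefschetzGenerationHilb5_of : Summit.Ventures.HodgeKum4.Theses.KummerFixedLocus.LefschetzGenerationHilb5 :=
  lefschetzGenerationHilbW_of_hilb (lefschetzGenerationHilb_of_stubs 5)

end Summit.Ventures.HodgeKum4.L1Hilb.V2p5Closer

namespace Summit.Ventures.HodgeKum4

/-- **L1-Hilb(n) for every `n`** (∀-instance form, lane (V); V2 mechanism, line v2p5 of p5 g0 with S-F from the p1/p2 halves). -/
theorem lefschetzGenerationHilb_all (n : ℕ) : LefschetzGenerationHilb n :=
  L1Hilb.V2p5Closer.lefschetzGenerationHilb_of_stubs n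

/-- **L1-Hilb(n), W-form, for every `n`.** -/
theorem lefschetzGenerationHilbW_all (n : ℕ) : LefschetzGenerationHilbW n :=
  lefschetzGenerationHilbW_of_hilb (lefschetzGenerationHilb_all n)

/-- **Item stmt-Ventures-20306 CLOSES**: the route decl `Theses.KummerFixedLocus.LefschetzGenerationHilb5`
(`= LefschetzGenerationHilbW 5`) holds. -/
theorem lefschetzGenerationHilb5_holds : Summit.Ventures.HodgeKum4.Theses.KummerFixedLocus.LefschetzGenerationHilb5 :=
  L1Hilb.V2p5Closer.LefschetzGenerationHilb5_of

end Summit.Ventures.HodgeKum4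

end
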